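import Mathlib
import Literature.AlgebraicGeometry.Resolution.FormalCoordinateChange
import Literature.AlgebraicGeometry.Resolution.FormalInverseFunction

/-!
# `WeightedInvariant.LocalWeightedDrop`, line `vertex-descent-weight-residues`: the unit root

Route `ResolutionOfSingularities/WeightedInvariant`, crux `LocalWeightedDrop`
(stmt-ResolutionOfSingularities-8899), stub `stub_unitRoot` of the lead's skeleton
`work/LocalWeightedDrop.lean`, PROVED here (statement verbatim from the ledger registration).

**Statement (UNIT ROOT).** Let `k` be a field, `m : ℕ` with `(m : k) ≠ 0` and `c : k` with `c ≠ 0`.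
Then the `1`-unit `1 + c⁻¹ · X_j` of `k[[X₀, …, Xₙ]]` has an `m`-th root `r` with constant term `1`
which involves only the variable `X_j` (every monomial `e` in the support of `r` has `e l = 0` for
all `l ≠ j`).  This is the torus reparametrisation `t = (1 + yᵢ/cᵢ)^{1/wᵢ}` at a TAME exceptional
point (`cᵢ ≠ 0`, `p ∤ wᵢ`) of the local weighted resolution game (consumed by `stub_tameSliceKappa`).

**Proof.** Work first in ONE variable `Y` (`MvPowerSeries (Fin 1) k`).  The substitution
`θ(Y) = c · ((1 + Y)^m - 1)` has zero constant term and linear part the `1 × 1` matrix `(c · m)`,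
a unit since `c ≠ 0` and `(m : k) ≠ 0` (the linear coefficient of `(1 + Y)^m` is `m`,
`coeff_single_one_add_X_pow`, by induction on `m`).  The FORMAL INVERSE FUNCTION THEOREM
(`FormalCoordChange.exists_comp_inverse`, in the tree) gives `ψ` with zero constant term and
`θ(ψ) = Y`, i.e. `c · ((1 + ψ)^m - 1) = Y`, so `ρ := 1 + ψ` satisfies `ρ^m = 1 + c⁻¹ Y` and has
constant term `1`.  Finally substitute `Y ↦ X_j` (`MvPowerSeries.subst`, a ring map fixing
constants): `r := ρ(X_j)` has `r^m = 1 + c⁻¹ X_j`, constant term `1`, and by the coefficient formula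
`MvPowerSeries.coeff_subst` every coefficient of `r` is a combination of coefficients of powers
`X_j^t`, which vanish off the exponents `single j t`.
-/

set_option linter.dupNamespace false -- mandated namespace of this single-conjunct summit

namespace Summit.ResolutionOfSingularities.ResolutionOfSingularities.Theorems

open Literature.AlgebraicGeometry.Resolution

/-- The linear coefficient of `(1 + X s)^m` is `m`. -/
private theorem coeff_single_one_add_X_pow {σ : Type*} (k : Type*) [Field k] (s : σ) (m : ℕ) :
    MvPowerSeries.coeff (Finsupp.single s 1) ((1 + MvPowerSeries.X s : MvPowerSeries σ k) ^ m) = m := by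
  classical
  induction m with
  | zero => simp [MvPowerSeries.coeff_one]
  | succ m ih =>
    have hX : MvPowerSeries.coeff (Finsupp.single s 1)
        ((1 + MvPowerSeries.X s : MvPowerSeries σ k) ^ m * MvPowerSeries.X s) = 1 := by
      have h := MvPowerSeries.coeff_add_mul_monomial (0 : σ →₀ ℕ) (Finsupp.single s 1)
        ((1 + MvPowerSeries.X s : MvPowerSeries σ k) ^ m) (1 : k)
      rw [zero_add, mul_one, MvPowerSeries.coeff_zero_eq_constantCoeff_apply, map_pow, map_add,
        MvPowerSeries.constantCoeff_one, MvPowerSeries.constantCoeff_X, add_zero, one_pow] at h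
      exact h
    rw [pow_succ, mul_add, mul_one, map_add, ih, hX, Nat.cast_succ]

/-- UNIT ROOT: over a field `k` with `(m : k) ≠ 0`, for `c ≠ 0` the `1`-unit `1 + c⁻¹ · X_j` of
`k[[X₀, …, Xₙ]]` has an `m`-th root with constant term `1` involving only the variable `X_j`. -/
theorem stub_unitRoot : ∀ (k : Type) [Field k] (n : ℕ) (j : Fin (n + 1)) (m : ℕ), (m : k) ≠ 0 → ∀ (c : k), c ≠ 0 →
    ∃ r : MvPowerSeries (Fin (n + 1)) k, MvPowerSeries.constantCoeff r = 1 ∧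
      r ^ m = 1 + MvPowerSeries.C c⁻¹ * MvPowerSeries.X j ∧
      ∀ e : Fin (n + 1) →₀ ℕ, MvPowerSeries.coeff e r ≠ 0 → ∀ l, l ≠ j → e l = 0 := by
  intro k _ n j m hm c hc
  classical
  -- Step 1: the `m`-th root `1 + φ` of `1 + c⁻¹ Y` in one variable, by the formal inverse function theorem.
  obtain ⟨φ, hφ0, hφm⟩ : ∃ φ : MvPowerSeries (Fin 1) k, MvPowerSeries.constantCoeff φ = 0 ∧
      (1 + φ) ^ m = 1 + MvPowerSeries.C c⁻¹ * MvPowerSeries.X 0 := by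
    let θ : Fin 1 → MvPowerSeries (Fin 1) k := fun _ =>
      MvPowerSeries.C c * ((1 + MvPowerSeries.X 0) ^ m - 1)
    have h0 : ∀ i, MvPowerSeries.constantCoeff (θ i) = 0 := by
      intro i
      simp [θ]
    have hdet : IsUnit (FormalCoordChange.linMat θ).det := by
      rw [Matrix.det_fin_one]
      simp only [FormalCoordChange.linMat, Matrix.of_apply, θ]
      rw [MvPowerSeries.coeff_C_mul, map_sub, coeff_single_one_add_X_pow, MvPowerSeries.coeff_one,
        if_neg (Finsupp.single_ne_zero.mpr one_ne_zero), sub_zero]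
      exact isUnit_iff_ne_zero.mpr (mul_ne_zero hc hm)
    obtain ⟨ψ, hψ0, hψθ, -⟩ := FormalCoordChange.exists_comp_inverse h0 hdet
    have hψs : MvPowerSeries.HasSubst ψ := MvPowerSeries.hasSubst_of_constantCoeff_zero hψ0
    refine ⟨ψ 0, hψ0 0, ?_⟩
    have key := hψθ 0
    simp only [θ] at key
    rw [← MvPowerSeries.coe_substAlgHom hψs] at key
    simp only [map_mul, map_sub, map_pow, map_add, map_one, MvPowerSeries.coe_substAlgHom,
      MvPowerSeries.subst_C, MvPowerSeries.subst_X hψs] at key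
    have key' : (1 + ψ 0) ^ m - 1 = MvPowerSeries.C c⁻¹ * MvPowerSeries.X 0 := by
      rw [← key, ← mul_assoc, ← map_mul, inv_mul_cancel₀ hc, map_one, one_mul]
    rw [← key']
    ring
  -- Step 2: push forward along `Y ↦ X j`.
  have ha : MvPowerSeries.HasSubst (fun _ : Fin 1 => (MvPowerSeries.X j : MvPowerSeries (Fin (n + 1)) k)) :=
    MvPowerSeries.hasSubst_of_constantCoeff_zero fun _ => MvPowerSeries.constantCoeff_X j
  refine ⟨MvPowerSeries.subst (fun _ : Fin 1 => (MvPowerSeries.X j : MvPowerSeries (Fin (n + 1)) k)) (1 + φ),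
    ?_, ?_, ?_⟩
  · rw [← MvPowerSeries.coe_substAlgHom ha, map_add, map_one, map_add, map_one,
      MvPowerSeries.coe_substAlgHom,
      MvPowerSeries.constantCoeff_subst_eq_zero ha (fun _ => MvPowerSeries.constantCoeff_X j) hφ0, add_zero]
  · rw [← MvPowerSeries.subst_pow ha, hφm, ← MvPowerSeries.coe_substAlgHom ha, map_add, map_one, map_mul,
      MvPowerSeries.coe_substAlgHom, MvPowerSeries.subst_C, MvPowerSeries.subst_X ha]
  · intro e he l hl
    by_contra hel
    apply he
    rw [MvPowerSeries.coeff_subst ha]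
    apply finsum_eq_zero_of_forall_eq_zero
    intro d
    have hprod : (d.prod fun (s : Fin 1) (t : ℕ) => (MvPowerSeries.X j : MvPowerSeries (Fin (n + 1)) k) ^ t) =
        MvPowerSeries.X j ^ (∑ s ∈ d.support, d s) :=
      Finset.prod_pow_eq_pow_sum _ _ _
    rw [hprod, MvPowerSeries.coeff_X_pow, if_neg, smul_zero]
    intro hed
    apply hel
    rw [hed, Finsupp.single_apply, if_neg (Ne.symm hl)]

end Summit.ResolutionOfSingularities.ResolutionOfSingularities.Theorems
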